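import Summits.QuantumFields.YangMills.Theorems.LuscherReductionTwistedTraceScalingBOStiffCentralWeight
import Summits.QuantumFields.YangMills.Theorems.LuscherReductionTwistedTraceScalingBOStiffCoreCoeff
import HarnessLib

/-!
# (B-ST) atom (B4d): the two-sided DENSITY COMPARISON `hν/hν'` of `spec_gap_inputs` at the central fibre, with the EXPLICIT flat model density
# `D(x) = N̄(β⁻¹)·e^{−‖P_Γ x̂‖²/β^{-2}}·e^{−2q_β(x̂)}` (lane A of S-BASE, crux `TwistedTraceScaling` stmt-QuantumFields-20203, C4-CORE, the (B-ST) pen; HANDOFF-g22 §DESIGN 3)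

The door (`…BOStiffDoorSlack.form_le_of_quasimode_of_comparison_slack`, packaged as `…BOStiffFibreGapDoor.hgap_of_door`) compares the fibre density `cΘ²·cW` of
`…BOStiffDefs` with a flat reference density `D` through β-free constants `Cν, C'ν` (`hν : cΘ²cW ≤ Cν·D`, `hν' : D ≤ C'ν·cΘ²cW` on `cS`).  By ✓`…BOStiffCentralWeight.cΘ_sq_mul_cW_eq`
the gauge Gaussian cancels: `cΘ²cW = N(orthoTube 1 x)·e^{−‖P_Γ x̂‖²/β^{-2}}·e^{−2q_β(x̂)}`, and by (P) ✓`…FPWeightCore.fpWeight_core_constant` the Faddeev–Popov weight `N` is the constant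
`N̄(β⁻¹) = fpWeightBar L (powScale 1 β)` up to `1 ± Cβ^{-2s}` on the fat tube, which contains `orthoTube 1 x` for `x ∈ cS` eventually (✓`…BOStiffCoreCoeff.eventually_orthoTube_one_mem_fatTube`).
★★ `central_density_compare` — for `L` with a non-zero site and `0 < s ≤ 1/3`: `∃ M₀ ≥ 2, ∀ M ≥ M₀, ∀ ε > 0, ∀ᶠ β, ∀ x ∈ cS L β`,
  `cΘ² cW ≤ (1+ε)·D β x` and `D β x ≤ (1+ε)·cΘ² cW`, `D β x = fpWeightBar L (powScale 1 β)·exp(−‖P_Γ(linkEmbed x)‖²/powScale 1 β²)·exp(−2·stiffGaussExp L (β/2) β (linkEmbed x))`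
(written out; no new definition).  This is the `D` the flat Poincaré chain (Mehler ⊗ resampling, hand w3) is to be proved for; `Cν = C'ν = 1 + ε` (any `ε > 0`).
Also ★ `central_density_pos`: `0 < D β x`, and `measurable_central_density`.
HONEST FRAMING: bookkeeping for a stub of a child of the CONDITIONAL route R2b1; (B-ST) OPEN (hJ, hflat, (A) remain); C4-CORE OPEN; not infinite volume, not a gap, not Clay.
-/

set_option autoImplicit false

noncomputable section

open MeasureTheory Filter Topology Real
open scoped BigOperators
open Literature.MathematicalPhysics.QuantumFieldTheory
open Literature.MathematicalPhysics.QuantumLattice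

namespace Summit.QuantumFields.YangMills.Theorems.FemtoTransferGap.TwoLattice.ConstTube

open Summit.QuantumFields.YangMills.Theorems.FemtoTransferGap
open Summit.QuantumFields.YangMills.Theorems.FemtoTransferGap.TwoLattice
open Summit.QuantumFields.YangMills.Theorems.FemtoTransferGap.TwoLattice.Avg
open Summit.QuantumFields.YangMills.Theorems.FemtoTransferGap.TwoLattice.Stiff
open Summit.QuantumFields.YangMills.Theorems.FemtoTransferGap.TwoLattice.GnChart
open Summit.QuantumFields.YangMills.Theorems.FemtoTransferGap.TwoLattice.Cov

variable {L : ℕ} [NeZero L]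

/-- ★ The model density is measurable in `x`. [folklore] -/
theorem measurable_central_density (β : ℝ) :
    Measurable fun x : Edge 3 L → Fin 3 → ℝ =>
      fpWeightBar L (powScale 1 β) * (Real.exp (-(‖(gaugeModes L).starProjection (linkEmbed L x)‖ ^ 2 / powScale 1 β ^ 2)) *
        Real.exp (-(2 * stiffGaussExp L (β / 2) β (linkEmbed L x)))) := by
  have h1 : Measurable fun x : Edge 3 L → Fin 3 → ℝ => ‖(gaugeModes L).starProjection (linkEmbed L x)‖ ^ 2 / powScale 1 β ^ 2 :=
    ((((gaugeModes L).starProjection.continuous.comp (linkEmbed L).continuous_of_finiteDimensional).norm.pow 2).div_const _).measurable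
  have h2 : Measurable fun x : Edge 3 L → Fin 3 → ℝ => 2 * stiffGaussExp L (β / 2) β (linkEmbed L x) :=
    (((continuous_stiffGaussExp (L := L) (β / 2) β).comp (linkEmbed L).continuous_of_finiteDimensional).measurable).const_mul 2
  exact measurable_const.mul ((h1.neg.exp).mul h2.neg.exp)

/-- ★ The model density is positive (`β` arbitrary). [folklore] -/
theorem central_density_pos (β : ℝ) (x : Edge 3 L → Fin 3 → ℝ) :
    0 < fpWeightBar L (powScale 1 β) * (Real.exp (-(‖(gaugeModes L).starProjection (linkEmbed L x)‖ ^ 2 / powScale 1 β ^ 2)) *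
        Real.exp (-(2 * stiffGaussExp L (β / 2) β (linkEmbed L x)))) :=
  mul_pos (fpWeightBar_pos L (powScale_pos 1 β)) (mul_pos (Real.exp_pos _) (Real.exp_pos _))

/-- ★★ **The density comparison `hν/hν'` of the fibre block with `Cν = C'ν = 1 + ε`**: for `L` with a non-zero site and `0 < s ≤ 1/3` there is `M₀ ≥ 2` such that for
`M ≥ M₀` and every `ε > 0`, eventually in `β`, for all `x ∈ cS L β`:
`cΘ² cW ≤ (1+ε)·N̄(β⁻¹)e^{−‖P_Γx̂‖²/β^{-2}}e^{−2q_β(x̂)}` and `N̄(β⁻¹)e^{−‖P_Γx̂‖²/β^{-2}}e^{−2q_β(x̂)} ≤ (1+ε)·cΘ² cW`. [cite: Luscher1983, §3] -/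
theorem central_density_compare (hLz : Nonempty (NzSite L)) {s : ℝ} (hs : 0 < s) (hs3 : s ≤ 1 / 3) :
    ∃ M₀ : ℝ, 2 ≤ M₀ ∧ ∀ M : ℝ, M₀ ≤ M → ∀ ε : ℝ, 0 < ε → ∀ᶠ β : ℝ in atTop, ∀ x ∈ cS L β,
      cΘ L β x ^ 2 * cW L s M β x ≤
          (1 + ε) * (fpWeightBar L (powScale 1 β) * (Real.exp (-(‖(gaugeModes L).starProjection (linkEmbed L x)‖ ^ 2 / powScale 1 β ^ 2)) *
            Real.exp (-(2 * stiffGaussExp L (β / 2) β (linkEmbed L x))))) ∧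
        fpWeightBar L (powScale 1 β) * (Real.exp (-(‖(gaugeModes L).starProjection (linkEmbed L x)‖ ^ 2 / powScale 1 β ^ 2)) *
            Real.exp (-(2 * stiffGaussExp L (β / 2) β (linkEmbed L x)))) ≤
          (1 + ε) * (cΘ L β x ^ 2 * cW L s M β x) := by
  -- (P): the Faddeev–Popov weight is constant on the fat tube of record
  have hδ0 : ∀ β, 0 < 43 * powScale s β := fun β => mul_pos (by norm_num) (powScale_pos s β)
  have hδ : Tendsto (fun β => 43 * powScale s β) atTop (𝓝 0) := by simpa using (tendsto_powScale hs).const_mul 43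
  have hsd1 : ∀ᶠ β in atTop, 0 < powScale 1 β ∧ powScale 1 β ≤ (43 * powScale s β) ^ 3 := by
    filter_upwards [eventually_ge_atTop (1 : ℝ)] with β hβ
    have h1 : powScale 1 β ≤ powScale s β ^ 3 := powScale_one_le_cube hs3 hβ
    have hps0 : 0 ≤ powScale s β ^ 3 := pow_nonneg (powScale_pos s β).le 3
    refine ⟨powScale_pos 1 β, h1.trans ?_⟩
    calc powScale s β ^ 3 = 1 * powScale s β ^ 3 := (one_mul _).symm
      _ ≤ 43 ^ 3 * powScale s β ^ 3 := mul_le_mul_of_nonneg_right (by norm_num) hps0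
      _ = (43 * powScale s β) ^ 3 := by ring
  obtain ⟨M₀, hM₀, H⟩ := fpWeight_core_constant L hLz hδ0 hδ hsd1
  refine ⟨M₀, hM₀, fun M hM ε hε => ?_⟩
  obtain ⟨C, β₀, hC, hP⟩ := H M hM
  have hM2 : 2 ≤ M := hM₀.trans hM
  have hδ2 : Tendsto (fun β => (43 * powScale s β) ^ 2) atTop (𝓝 0) := by simpa using hδ.pow 2
  have hκ : (0 : ℝ) < ε / (1 + ε) := by positivity
  have hs2 : s < 1 / 2 := by linarith
  filter_upwards [eventually_ge_atTop β₀, eventually_mul_le_of_tendsto hδ2 C hκ, eventually_orthoTube_one_mem_fatTube (L := L) hs hs2 hM2] with β hβ hCδ hfat x hx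
  -- the fat tube contains the central tube point
  have hne : cΘ L β x ≠ 0 := hx
  unfold cΘ cΩ at hne
  have hF := hfat x hne
  -- (P) at that point, in the vocabulary of `recordChi`
  have hPx := hP β hβ (orthoTube L 1 x) hF
  have hNeq : gaugeAvg (recordWeightRho L (fun β => 43 * powScale s β) (fun b => M * (43 * powScale s b)) (powScale 1) β) (orthoTube L 1 x) =
      gaugeAvg (recordChi L s 43 M β) (orthoTube L 1 x) := by rfl
  rw [hNeq] at hPx
  obtain ⟨hlo, hhi⟩ := hPx
  set N := gaugeAvg (recordChi L s 43 M β) (orthoTube L 1 x) with hN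
  set Nbar := fpWeightBar L (powScale 1 β) with hNbar
  set δ2 := (43 * powScale s β) ^ 2 with hδ2def
  set G := Real.exp (-(‖(gaugeModes L).starProjection (linkEmbed L x)‖ ^ 2 / powScale 1 β ^ 2)) *
      Real.exp (-(2 * stiffGaussExp L (β / 2) β (linkEmbed L x))) with hG
  have hG0 : 0 < G := mul_pos (Real.exp_pos _) (Real.exp_pos _)
  have hNbar0 : 0 < Nbar := fpWeightBar_pos L (powScale_pos 1 β)
  have hid : cΘ L β x ^ 2 * cW L s M β x = N * G := by rw [hN, hG]; exact cΘ_sq_mul_cW_eq (L := L) s M β hx hF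
  -- `Cδ² ≤ ε/(1+ε) ≤ ε`, so `1 + Cδ² ≤ 1 + ε` and `1 ≤ (1+ε)(1 − Cδ²)`
  have hCδ' : C * δ2 ≤ ε := hCδ.trans (div_le_self hε.le (by linarith))
  have hCδ0 : 0 ≤ C * δ2 := mul_nonneg hC (sq_nonneg _)
  have h1ε : (1 + ε) * (ε / (1 + ε)) = ε := by field_simp
  have hlow : 1 ≤ (1 + ε) * (1 - C * δ2) := by nlinarith
  rw [hid]
  constructor
  · calc N * G ≤ Nbar * (1 + C * δ2) * G := mul_le_mul_of_nonneg_right hhi hG0.le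
      _ ≤ Nbar * (1 + ε) * G := by gcongr
      _ = (1 + ε) * (Nbar * G) := by ring
  · calc Nbar * G = 1 * (Nbar * G) := (one_mul _).symm
      _ ≤ (1 + ε) * (1 - C * δ2) * (Nbar * G) := mul_le_mul_of_nonneg_right hlow (mul_pos hNbar0 hG0).le
      _ = (1 + ε) * (Nbar * (1 - C * δ2) * G) := by ring
      _ ≤ (1 + ε) * (N * G) := by
          have h := mul_le_mul_of_nonneg_right hlo hG0.le
          exact mul_le_mul_of_nonneg_left h (by linarith)

end Summit.QuantumFields.YangMills.Theorems.FemtoTransferGap.TwoLattice.ConstTube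

end
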